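import Summits.ResolutionOfSingularities.ResolutionOfSingularities.Theorems.HilbertSamuelEliminationSigmaMaxModificationsCorridor3SigmaTameLowSncDefect
import HarnessLib

/-!
# [OURS · L1 W4.2] TAME-LOW row T-L4 «SNC PHASE, lineage-local» — part 2b: THE STEP THEOREM — the snc defect of a finite configuration
# of regular branches DROPS STRICTLY (lexicographically) under the blow-up of a non-snc point, and snc persists
# (cell res-hironaka, LADDER-RESOLUTION rung L; slot W4.2, crux chain w42 `SigmaMaxModificationsCorridor3` stmt-ResolutionOfSingularities-19249 /
# crux `SigmaMaxModifications` stmt-…-18506; res-L1-w42-plan-1 RULING v3.14-48 (PD)(iv)/(vi)/(PF) row T-L4 → res-L1-w42-stub-4 (gen 7);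
# `--supports stmt-ResolutionOfSingularities-19249 --as helper`; consumers: res-D-pv-002 ((TL6) fuel: the tangency/crowding coordinates of the
# TAME-LOW fuel), res-L1-type-o1 (`TameLowPrescription` «lineage point while … snc fails»), res-L1-s42-pv-2 (T-L5 board: snc rays))

HONEST FRAMING.  OURS bookkeeping for the TAME-LOW tier (RULING v3.14-48 (PD)(iv)): the classical embedded-resolution count for a
finite set of REGULAR plane branches (after the singular-branch half — `δ`-drop, `IsQuadraticTransform.curveDelta_lt` — has made every
branch through the lineage point regular), in the `Subring K` / `IsQuadraticTransform` currency. Nothing here is a statement of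
H. Hironaka's manuscript [Hironaka2017] (CANDIDATE, never a premise) nor of Cossart–Jannsen–Saito; no named fact; every theorem PROVED.
AI-written; weaker than expert review.

OBJECTS (part 2a `…SncDefect`; a configuration is a `Finset K` of branch equations at the local ring `R ⊆ K`):
* `IsRegularBranch R f` — `f ∈ 𝔪_R ∖ 𝔪_R²`; `contactAt R f g ∈ ℕ∞` — the order of contact of part 1a for `f, g ∈ R` (junk `0` otherwise);
* `SncAt R B` — **the configuration is snc at `R`**: at most two branches, each regular, pairwise of contact `1` (i.e. any two form a
  regular system of parameters, part 1a `span_pair_eq_maximalIdeal_iff_contactOrder_eq_one`);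
* `pairDefect R B = Σ_{f, g ∈ B} (contactAt R f g − 1)` (diagonal and transversal terms vanish: the TANGENCY excess) and
  `crowding B = #B − 2`; **`sncDefect R B = (pairDefect, crowding) ∈ ℕ ×ₗ ℕ`**;
* `transformAt R₁ x B = {x} ∪ {g/x : g ∈ B, g/x ∈ 𝔪_{R₁}}` — the configuration at the point `R₁` of the blow-up (chart element `x`):
  the strict transforms passing through `R₁` and the exceptional branch.

THEOREMS, for `R ⊆ R₁` two-dimensional regular local rings of `K`, `R₁` a quadratic transform of `R` in the chart of `x ∈ 𝔪_R ∖ 0`,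
`B` a finite configuration of regular branches at `R` with pairwise finite contact (distinct branches):
* `pairDefect_transformAt_add_le` — `pairDefect R₁ (transformAt R₁ x B) + #{(f, g) ∈ T², f ≠ g} ≤ pairDefect R B` for `T ⊆ B` the
  branches through `R₁` (each such pair loses exactly one order of contact, part 1b; pairs against `x` contribute nothing);
* **`sncDefect_transformAt_lt`** — if `B` is NOT snc at `R` then `sncDefect R₁ (transformAt R₁ x B) < sncDefect R B`;
* **`sncAt_transformAt`** — if `B` is snc at `R` then so is the transform at `R₁` (snc persists under further point blow-ups);
So along any lineage of point blow-ups the snc phase at an all-regular point ends after at most «`sncDefect`» steps (well-founded on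
`ℕ ×ₗ ℕ`); part 3 (`…SncLineage`) records the lineage statement, with the singular-branch half as its entry hypothesis.

References: The Stacks Project, Tags 0BI7, 0BIC (Lemmas 54.15.3, 54.15.6) [StacksProject]; R. Hartshorne, *Algebraic Geometry*,
V Thm. 3.9 [Hartshorne1977]; C. Huneke, I. Swanson (2006), §14.2 [HunekeSwanson2006].
-/

noncomputable section

set_option linter.dupNamespace false -- mandated namespace of this single-conjunct summit

open IsLocalRing Literature.AlgebraicGeometry.Resolution
open scoped Classical

namespace Summit.ResolutionOfSingularities.ResolutionOfSingularities.Theorems.SigmaMaxModificationsCorridor3.TameLowSnc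

universe u

variable {K : Type u} [Field K]

section Step

variable {R R₁ : Subring K} [IsRegularLocalRing R] [IsRegularLocalRing R₁]

/-- **The tangency excess of the transform is controlled by that of `B`**: with `T ⊆ B` the branches through `R₁`,
`pairDefect R₁ (transformAt R₁ x B) + Σ_{f, g ∈ T} [f ≠ g] ≤ pairDefect R B` (each pair through `R₁` loses exactly one order of
contact; pairs with the exceptional branch contribute nothing). [OURS · proved] -/
theorem pairDefect_transformAt_add_le (hdim : ringKrullDim R = 2) (hdim₁ : ringKrullDim R₁ = 2)
    (hq : IsQuadraticTransform R R₁) {x : R} (hx : x ∈ maximalIdeal R) (hx0 : x ≠ 0) (hT : blowupRing R (x : K) ≤ R₁)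
    {B : Finset K} (hB : ∀ f ∈ B, IsRegularBranch R f) (hfin : ∀ f ∈ B, ∀ g ∈ B, f ≠ g → contactAt R f g ≠ ⊤) :
    pairDefect R₁ (transformAt R₁ ((x : R) : K) B) +
      ∑ f ∈ B.filter (fun g => ∃ h : g / (x : K) ∈ R₁, (⟨g / (x : K), h⟩ : R₁) ∈ maximalIdeal R₁),
        ∑ g ∈ B.filter (fun g => ∃ h : g / (x : K) ∈ R₁, (⟨g / (x : K), h⟩ : R₁) ∈ maximalIdeal R₁), (if f = g then 0 else 1) ≤
      pairDefect R B := by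
  have hx0K : ((x : R) : K) ≠ 0 := fun e => hx0 (Subtype.ext e)
  set T := B.filter (fun g => ∃ h : g / (x : K) ∈ R₁, (⟨g / (x : K), h⟩ : R₁) ∈ maximalIdeal R₁) with hTdef
  have hTB : T ⊆ B := Finset.filter_subset _ _
  have hTmem : ∀ g ∈ T, g ∈ B ∧ ∃ h : g / (x : K) ∈ R₁, (⟨g / (x : K), h⟩ : R₁) ∈ maximalIdeal R₁ := fun g hg => Finset.mem_filter.mp hg
  obtain ⟨hBeq, hxnot⟩ := transformAt_eq_insert_image (R₁' := R₁) hx hx0 hB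
  have hinj : Set.InjOn (fun g : K => g / ((x : R) : K)) (T : Set K) := fun a _ b _ h => (div_left_inj' hx0K).mp h
  -- the terms against the exceptional branch vanish
  have hxR₁ : ((x : R) : K) ∈ R₁ := hq.dominates.1 x.2
  have hzero₁ : ∀ q ∈ transformAt R₁ ((x : R) : K) B, (contactAt R₁ ((x : R) : K) q).toNat - 1 = 0 := by
    intro q hq'
    rcases mem_transformAt_iff.mp hq' with rfl | ⟨g, hgB, rfl, hgx⟩
    · simp only [contactAt_self hxR₁, ENat.toNat_top, Nat.zero_sub]
    · rw [(contactAt_chart_div_eq_one hdim hdim₁ hq hx hx0 hT (hB g hgB) hgx).2]; rfl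
  have hzero₂ : ∀ q ∈ transformAt R₁ ((x : R) : K) B, (contactAt R₁ q ((x : R) : K)).toNat - 1 = 0 := by
    intro q hq'
    rcases mem_transformAt_iff.mp hq' with rfl | ⟨g, hgB, rfl, hgx⟩
    · simp only [contactAt_self hxR₁, ENat.toNat_top, Nat.zero_sub]
    · rw [(contactAt_chart_div_eq_one hdim hdim₁ hq hx hx0 hT (hB g hgB) hgx).1]; rfl
  -- `pairDefect R₁ B₁ = Σ_{T×T} d₁(f/x, g/x)`
  have hPD : pairDefect R₁ (transformAt R₁ ((x : R) : K) B) =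
      ∑ f ∈ T, ∑ g ∈ T, ((contactAt R₁ (f / (x : K)) (g / (x : K))).toNat - 1) := by
    unfold pairDefect
    rw [hBeq, Finset.sum_insert hxnot, Finset.sum_eq_zero (fun q hq' => hzero₁ q (hBeq ▸ hq')), zero_add,
      Finset.sum_image hinj]
    refine Finset.sum_congr rfl fun f hf => ?_
    rw [Finset.sum_insert hxnot, hzero₂ _ (hBeq ▸ Finset.mem_insert_of_mem (Finset.mem_image_of_mem _ hf)), zero_add,
      Finset.sum_image hinj]
  -- termwise: `d₁(f/x, g/x) + [f ≠ g] = d(f, g)` on `T × T`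
  have hterm : ∀ f ∈ T, ∀ g ∈ T,
      ((contactAt R₁ (f / (x : K)) (g / (x : K))).toNat - 1) + (if f = g then 0 else 1) = (contactAt R f g).toNat - 1 := by
    intro f hf g hg
    obtain ⟨hfB, hfx⟩ := hTmem f hf
    obtain ⟨hgB, hgx⟩ := hTmem g hg
    by_cases hfg : f = g
    · subst hfg
      obtain ⟨hfR, -, -⟩ := hB f hfB
      rw [if_pos rfl, contactAt_self hfR, contactAt_self hfx.1, ENat.toNat_top]
    · rw [if_neg hfg]
      obtain ⟨n, hn⟩ := ENat.ne_top_iff_exists.mp (hfin f hfB g hgB hfg)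
      obtain ⟨h2, hc⟩ := two_le_and_contactAt_div_div hdim hdim₁ hq hx hx0 hT (hB f hfB) (hB g hgB) hfx hgx hn.symm
      rw [hc, ← hn, ENat.toNat_coe, ENat.toNat_coe]
      omega
  calc pairDefect R₁ (transformAt R₁ ((x : R) : K) B) + ∑ f ∈ T, ∑ g ∈ T, (if f = g then 0 else 1)
      = ∑ f ∈ T, ∑ g ∈ T, ((contactAt R f g).toNat - 1) := by
        rw [hPD, ← Finset.sum_add_distrib]
        refine Finset.sum_congr rfl fun f hf => ?_
        rw [← Finset.sum_add_distrib]
        exact Finset.sum_congr rfl fun g hg => hterm f hf g hg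
    _ ≤ ∑ f ∈ T, ∑ g ∈ B, ((contactAt R f g).toNat - 1) :=
        Finset.sum_le_sum fun f _ => Finset.sum_le_sum_of_subset hTB
    _ ≤ pairDefect R B := Finset.sum_le_sum_of_subset hTB

/-- **THE STEP THEOREM — the snc defect drops strictly at a non-snc point.**  `R ⊆ R₁` two-dimensional regular local rings of `K`,
`R₁` a quadratic transform of `R` in the chart of `x ∈ 𝔪_R ∖ 0`; `B` a finite configuration of regular branches at `R` with pairwise
finite contact, NOT snc at `R`. Then `sncDefect R₁ (transformAt R₁ x B) < sncDefect R B` in `ℕ ×ₗ ℕ`. (If two tangent branches stay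
together the tangency excess drops; otherwise at most one old branch passes through `R₁` and the transform is snc outright.)
[OURS · proved; classical — The Stacks Project Tag 0BIC, Hartshorne V.3.9] -/
theorem sncDefect_transformAt_lt (hdim : ringKrullDim R = 2) (hdim₁ : ringKrullDim R₁ = 2)
    (hq : IsQuadraticTransform R R₁) {x : R} (hx : x ∈ maximalIdeal R) (hx0 : x ≠ 0) (hT : blowupRing R (x : K) ≤ R₁)
    {B : Finset K} (hB : ∀ f ∈ B, IsRegularBranch R f) (hfin : ∀ f ∈ B, ∀ g ∈ B, f ≠ g → contactAt R f g ≠ ⊤)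
    (hnot : ¬ SncAt R B) :
    sncDefect R₁ (transformAt R₁ ((x : R) : K) B) < sncDefect R B := by
  have hx0K : ((x : R) : K) ≠ 0 := fun e => hx0 (Subtype.ext e)
  have hle := pairDefect_transformAt_add_le hdim hdim₁ hq hx hx0 hT hB hfin
  obtain ⟨hBeq, hxnot⟩ := transformAt_eq_insert_image (R₁' := R₁) hx hx0 hB
  set T := B.filter (fun g => ∃ h : g / (x : K) ∈ R₁, (⟨g / (x : K), h⟩ : R₁) ∈ maximalIdeal R₁) with hTdef
  have hTmem : ∀ g ∈ T, g ∈ B ∧ ∃ h : g / (x : K) ∈ R₁, (⟨g / (x : K), h⟩ : R₁) ∈ maximalIdeal R₁ := fun g hg => Finset.mem_filter.mp hg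
  unfold sncDefect
  rw [Prod.Lex.toLex_lt_toLex]
  by_cases h2 : ∃ f ∈ T, ∃ g ∈ T, f ≠ g
  · -- two tangent branches stay together: the tangency excess drops
    left
    obtain ⟨f, hf, g, hg, hfg⟩ := h2
    have h1 : 1 ≤ ∑ f ∈ T, ∑ g ∈ T, (if f = g then 0 else 1 : ℕ) := by
      calc (1 : ℕ) = (if f = g then 0 else 1) := by rw [if_neg hfg]
        _ ≤ ∑ g ∈ T, (if f = g then 0 else 1 : ℕ) :=
            Finset.single_le_sum (f := fun g => (if f = g then 0 else 1 : ℕ)) (fun _ _ => Nat.zero_le _) hg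
        _ ≤ ∑ f ∈ T, ∑ g ∈ T, (if f = g then 0 else 1 : ℕ) :=
            Finset.single_le_sum (f := fun f => ∑ g ∈ T, (if f = g then 0 else 1 : ℕ)) (fun _ _ => Nat.zero_le _) hf
    change pairDefect R₁ (transformAt R₁ ((x : R) : K) B) < pairDefect R B
    omega
  · -- at most one old branch passes through `R₁`: the transform has defect `(0, 0)`, and `B` has positive defect
    push Not at h2
    have hTcard : T.card ≤ 1 := Finset.card_le_one.mpr fun a ha b hb => h2 a ha b hb
    have hcard₁ : (transformAt R₁ ((x : R) : K) B).card ≤ 2 := by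
      rw [hBeq, Finset.card_insert_of_notMem hxnot]
      have := Finset.card_image_le (s := T) (f := fun g : K => g / ((x : R) : K))
      omega
    have hPD₁ : pairDefect R₁ (transformAt R₁ ((x : R) : K) B) = 0 := by
      have hsum0 : ∑ f ∈ T, ∑ g ∈ T, (if f = g then 0 else 1 : ℕ) = 0 :=
        Finset.sum_eq_zero fun f hf => Finset.sum_eq_zero fun g hg => by rw [if_pos (h2 f hf g hg)]
      -- from `hle` with `Σ[f≠g] = 0` we only get `≤`; compute directly: all pairs through `R₁` coincide or involve `x`
      unfold pairDefect
      refine Finset.sum_eq_zero fun p hp => Finset.sum_eq_zero fun q hq' => ?_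
      rcases mem_transformAt_iff.mp hp with rfl | ⟨f, hfB, rfl, hfx⟩ <;>
        rcases mem_transformAt_iff.mp hq' with rfl | ⟨g, hgB, rfl, hgx⟩
      · simp only [contactAt_self (hq.dominates.1 x.2), ENat.toNat_top, Nat.zero_sub]
      · rw [(contactAt_chart_div_eq_one hdim hdim₁ hq hx hx0 hT (hB g hgB) hgx).2]; rfl
      · rw [(contactAt_chart_div_eq_one hdim hdim₁ hq hx hx0 hT (hB f hfB) hfx).1]; rfl
      · have hfT : f ∈ T := Finset.mem_filter.mpr ⟨hfB, hfx⟩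
        have hgT : g ∈ T := Finset.mem_filter.mpr ⟨hgB, hgx⟩
        simp only [h2 f hfT g hgT, contactAt_self hgx.1, ENat.toNat_top, Nat.zero_sub]
    have hcrowd₁ : crowding (transformAt R₁ ((x : R) : K) B) = 0 := by unfold crowding; omega
    -- `B` is not snc: positive defect
    have hpos : 0 < pairDefect R B ∨ (pairDefect R B = 0 ∧ 0 < crowding B) := by
      by_contra hcon
      push Not at hcon
      have hPD0 : pairDefect R B = 0 := by omega
      have hcr0 : crowding B = 0 := by
        rcases Nat.eq_zero_or_pos (pairDefect R B) with h | h
        · exact Nat.le_zero.mp (hcon.2 h)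
        · omega
      apply hnot
      refine ⟨by unfold crowding at hcr0; omega, hB, fun f hf g hg hfg => ?_⟩
      obtain ⟨n, hn⟩ := ENat.ne_top_iff_exists.mp (hfin f hf g hg hfg)
      -- the `(f, g)` term of `pairDefect R B` vanishes, so `n ≤ 1`; and `n ≥ 1` since `g ∈ 𝔪`
      have hterm : (contactAt R f g).toNat - 1 = 0 := by
        have h1 : (contactAt R f g).toNat - 1 ≤ ∑ g ∈ B, ((contactAt R f g).toNat - 1) :=
          Finset.single_le_sum (f := fun g => (contactAt R f g).toNat - 1) (fun _ _ => Nat.zero_le _) hg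
        have h2' : ∑ g ∈ B, ((contactAt R f g).toNat - 1) ≤ pairDefect R B :=
          Finset.single_le_sum (f := fun f => ∑ g ∈ B, ((contactAt R f g).toNat - 1)) (fun _ _ => Nat.zero_le _) hf
        omega
      obtain ⟨hfR, hfm, -⟩ := hB f hf
      obtain ⟨hgR, hgm, -⟩ := hB g hg
      have hge : (1 : ℕ∞) ≤ contactAt R f g := by
        rw [show f = ((⟨f, hfR⟩ : R) : K) from rfl, show g = ((⟨g, hgR⟩ : R) : K) from rfl, contactAt_eq]
        exact one_le_contactOrder_of_mem hgm
      rw [← hn] at hterm hge ⊢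
      rw [ENat.toNat_coe] at hterm
      have : 1 ≤ n := by exact_mod_cast hge
      exact_mod_cast (show n = 1 by omega)
    change pairDefect R₁ _ < pairDefect R B ∨ pairDefect R₁ _ = pairDefect R B ∧ crowding _ < crowding B
    rw [hPD₁, hcrowd₁]
    rcases hpos with h | ⟨h0, hc⟩
    · exact Or.inl h
    · exact Or.inr ⟨h0.symm, hc⟩

/-- **SNC PERSISTS**: if `B` is snc at `R` then its transform is snc at `R₁` (at most one old branch, transversal to `x`, passes
through `R₁`). [OURS · proved] -/
theorem sncAt_transformAt (hdim : ringKrullDim R = 2) (hdim₁ : ringKrullDim R₁ = 2)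
    (hq : IsQuadraticTransform R R₁) {x : R} (hx : x ∈ maximalIdeal R) (hx0 : x ≠ 0) (hT : blowupRing R (x : K) ≤ R₁)
    {B : Finset K} (hsnc : SncAt R B) : SncAt R₁ (transformAt R₁ ((x : R) : K) B) := by
  obtain ⟨hcard, hB, hone⟩ := hsnc
  obtain ⟨hBeq, hxnot⟩ := transformAt_eq_insert_image (R₁' := R₁) hx hx0 hB
  set T := B.filter (fun g => ∃ h : g / (x : K) ∈ R₁, (⟨g / (x : K), h⟩ : R₁) ∈ maximalIdeal R₁) with hTdef
  -- no two distinct old branches pass through `R₁`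
  have h2 : ∀ f ∈ T, ∀ g ∈ T, f = g := by
    intro f hf g hg
    by_contra hfg
    obtain ⟨hfB, hfx⟩ := Finset.mem_filter.mp hf
    obtain ⟨hgB, hgx⟩ := Finset.mem_filter.mp hg
    have h := (two_le_and_contactAt_div_div hdim hdim₁ hq hx hx0 hT (hB f hfB) (hB g hgB) hfx hgx
      (hone f hfB g hgB hfg)).1
    omega
  refine ⟨?_, isRegularBranch_transformAt hdim hdim₁ hq hx hx0 hT hB, ?_⟩
  · rw [hBeq, Finset.card_insert_of_notMem hxnot]
    have hTcard : T.card ≤ 1 := Finset.card_le_one.mpr fun a ha b hb => h2 a ha b hb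
    have := Finset.card_image_le (s := T) (f := fun g : K => g / ((x : R) : K))
    omega
  · intro p hp q hq' hpq
    rcases mem_transformAt_iff.mp hp with rfl | ⟨f, hfB, rfl, hfx⟩ <;>
      rcases mem_transformAt_iff.mp hq' with rfl | ⟨g, hgB, rfl, hgx⟩
    · exact absurd rfl hpq
    · exact (contactAt_chart_div_eq_one hdim hdim₁ hq hx hx0 hT (hB g hgB) hgx).2
    · exact (contactAt_chart_div_eq_one hdim hdim₁ hq hx hx0 hT (hB f hfB) hfx).1
    · exfalso
      have hfT : f ∈ T := Finset.mem_filter.mpr ⟨hfB, hfx⟩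
      have hgT : g ∈ T := Finset.mem_filter.mpr ⟨hgB, hgx⟩
      exact hpq (by rw [h2 f hfT g hgT])

end Step

end Summit.ResolutionOfSingularities.ResolutionOfSingularities.Theorems.SigmaMaxModificationsCorridor3.TameLowSnc

end
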